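import Summits.Ventures.PercRepro.RankLevelSetMinorPairDiag
import Summits.Ventures.PercRepro.RankLevelSetBiIndepContainSkewUniform

/-! # RankLevelSetMinorPairDiagPaving — EVERY PAVING MATROID SATISFIES (Diag), HENCE THE CUMULATIVE SKEW ON EVERY
PAIR OF ITS COMPLEMENTARY MINORS, (M₀), (CX*) (night-1 g29; dossier §41.12)

In a paving matroid every subset of the ground set with fewer than `rank` elements is independent. For a pair of
disjoint independent `Y₁, Y₂ ⊆ E` with `r₁ ≥ r₂` (`r(E ∖ Y₁) + #Y₁ ≤ r(E ∖ Y₂) + #Y₂`) and a level `i` below the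
middle (`2i + 1 < m`) with `p_i ≠ 0`, the reflected level `j = m − 1 − i` is INTERIOR on both sides: a `j`-set `S` has
`#(S ∪ Y₁) = j + #Y₁ ≤ r(E ∖ Y₂) − 1 < rank` (from `m − i + #Y₂ ≤ r(E ∖ Y₁)`, witnessed by any member of level `i`,
and `r₁ ≥ r₂`) and `#(S^c ∪ Y₂) = i + 1 + #Y₂ < m − i + #Y₂ ≤ rank` (from `2i + 1 < m`). So `p_j = C(m, j)` is the
FULL binomial row while `p_i ≤ C(m, i) ≤ C(m, j)` (`i < j ≤ m − i`): **`minorPairDiagSkew_of_paving`**. Through the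
joint induction of `RankLevelSetMinorPairDiag`: **`minorPairEqualRankSkew_of_paving`** ((M₀) for paving matroids),
**`minorPairSkew_of_paving`** (the cumulative skew with the natural parameter on EVERY pair of complementary minors
of a paving matroid), and `biContainSkew_of_paving'` (a second proof of g28's (CX*) for paving matroids, now as a
corollary of the pair theory); with `uniform_paving`: **`minorPairDiagSkew_uniform`**, **`minorPairEqualRankSkew_uniform`**. Every declaration has a
docstring; imports: the cell's own modules and Mathlib only. Axioms: standard. -/

namespace PercRepro

open Set Matroid

variable {α : Type} (M : Matroid α) [M.Finite]

/-- A mixed profile is at most the binomial row: `p_i(Y₁,Y₂) ≤ C(m, i)`. -/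
lemma minorPairCount_le_choose (Y₁ Y₂ : Set α) (i : ℕ) :
    minorPairCount M Y₁ Y₂ i ≤ (M.E \ (Y₁ ∪ Y₂)).ncard.choose i := by
  have hfin : (M.E \ (Y₁ ∪ Y₂)).Finite := M.ground_finite.subset Set.sdiff_subset
  rw [← ncard_subsets_of_finite hfin i]
  unfold minorPairCount minorPairSets
  exact Set.ncard_le_ncard (fun S hS => ⟨hS.1, hS.2.1⟩) (hfin.finite_subsets.subset (fun _ hS => hS.1))

/-- In a paving matroid a level whose sets are small on both sides is the full binomial row:
`p_j(Y₁,Y₂) = C(m, j)` when `j + #Y₁ < rank` and `m − j + #Y₂ < rank`. -/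
lemma minorPairCount_eq_choose_of_paving (h : Paving M) {Y₁ Y₂ : Set α} (hY₁ : Y₁ ⊆ M.E) (hY₂ : Y₂ ⊆ M.E)
    {j : ℕ} (hj : ((j + Y₁.ncard : ℕ) : ℕ∞) < M.eRank)
    (hj' : (((M.E \ (Y₁ ∪ Y₂)).ncard - j + Y₂.ncard : ℕ) : ℕ∞) < M.eRank) :
    minorPairCount M Y₁ Y₂ j = (M.E \ (Y₁ ∪ Y₂)).ncard.choose j := by
  have hfin : (M.E \ (Y₁ ∪ Y₂)).Finite := M.ground_finite.subset Set.sdiff_subset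
  have hY₁fin : Y₁.Finite := M.ground_finite.subset hY₁
  have hY₂fin : Y₂.Finite := M.ground_finite.subset hY₂
  rw [← ncard_subsets_of_finite hfin j]
  unfold minorPairCount minorPairSets
  congr 1
  ext S
  simp only [Set.mem_setOf_eq]
  constructor
  · rintro ⟨hSE, hScard, -, -⟩; exact ⟨hSE, hScard⟩
  · rintro ⟨hSE, hScard⟩
    have hSfin : S.Finite := hfin.subset hSE
    have hdisj₁ : Disjoint S Y₁ := by
      rw [Set.disjoint_left]; intro x hxS hxY; exact (hSE hxS).2 (Or.inl hxY)
    have hdisj₂ : Disjoint ((M.E \ (Y₁ ∪ Y₂)) \ S) Y₂ := by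
      rw [Set.disjoint_left]; intro x hx hxY; exact hx.1.2 (Or.inr hxY)
    refine ⟨hSE, hScard, ?_, ?_⟩
    · refine h (S ∪ Y₁) (Set.union_subset (hSE.trans Set.sdiff_subset) hY₁) ?_
      rw [← (hSfin.union hY₁fin).cast_ncard_eq, Set.ncard_union_eq hdisj₁ hSfin hY₁fin, hScard]
      exact hj
    · refine h (((M.E \ (Y₁ ∪ Y₂)) \ S) ∪ Y₂) (Set.union_subset (Set.sdiff_subset.trans Set.sdiff_subset) hY₂) ?_
      rw [← ((hfin.subset Set.sdiff_subset).union hY₂fin).cast_ncard_eq,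
        Set.ncard_union_eq hdisj₂ (hfin.subset Set.sdiff_subset) hY₂fin, Set.ncard_sdiff' hSE hfin, hScard]
      exact hj'

/-- The support of a mixed profile: a member of level `i` gives `m − i + #Y₂ ≤ r(E ∖ Y₁)` and `i + #Y₁ ≤ r(E ∖ Y₂)`. -/
lemma minorPairCount_support {Y₁ Y₂ : Set α} (hY₁ : Y₁ ⊆ M.E) (hY₂ : Y₂ ⊆ M.E) (hdisj : Disjoint Y₁ Y₂) {i : ℕ}
    (hne : minorPairCount M Y₁ Y₂ i ≠ 0) :
    (M.E \ (Y₁ ∪ Y₂)).ncard - i + Y₂.ncard ≤ mpRk M (M.E \ Y₁) ∧ i + Y₁.ncard ≤ mpRk M (M.E \ Y₂) := by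
  have hfin : (M.E \ (Y₁ ∪ Y₂)).Finite := M.ground_finite.subset Set.sdiff_subset
  have hY₁fin : Y₁.Finite := M.ground_finite.subset hY₁
  have hY₂fin : Y₂.Finite := M.ground_finite.subset hY₂
  obtain ⟨S, hSE, hScard, hind, hind'⟩ := Set.nonempty_of_ncard_ne_zero hne
  have hSfin : S.Finite := hfin.subset hSE
  constructor
  · have hsub : ((M.E \ (Y₁ ∪ Y₂)) \ S) ∪ Y₂ ⊆ M.E \ Y₁ := by
      intro x hx
      rcases hx with hx | hx
      · exact ⟨hx.1.1, fun h => hx.1.2 (Or.inl h)⟩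
      · exact ⟨hY₂ hx, fun h => Set.disjoint_left.mp hdisj h hx⟩
    have h1 := mpRk_mono M hsub
    rw [mpRk_indep M hind'] at h1
    have hdisj₂ : Disjoint ((M.E \ (Y₁ ∪ Y₂)) \ S) Y₂ := by
      rw [Set.disjoint_left]; intro x hx hxY; exact hx.1.2 (Or.inr hxY)
    rw [Set.ncard_union_eq hdisj₂ (hfin.subset Set.sdiff_subset) hY₂fin, Set.ncard_sdiff' hSE hfin, hScard] at h1
    exact h1
  · have hsub : S ∪ Y₁ ⊆ M.E \ Y₂ := by
      intro x hx
      rcases hx with hx | hx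
      · exact ⟨(hSE hx).1, fun h => (hSE hx).2 (Or.inr h)⟩
      · exact ⟨hY₁ hx, fun h => Set.disjoint_left.mp hdisj hx h⟩
    have h1 := mpRk_mono M hsub
    rw [mpRk_indep M hind] at h1
    have hdisj₁ : Disjoint S Y₁ := by
      rw [Set.disjoint_left]; intro x hxS hxY; exact (hSE hxS).2 (Or.inl hxY)
    rw [Set.ncard_union_eq hdisj₁ hSfin hY₁fin, hScard] at h1
    exact h1

/-- `mpRk` of any set is at most the rank of the matroid. -/
lemma mpRk_le_eRank (X : Set α) : ((mpRk M X : ℕ) : ℕ∞) ≤ M.eRank := by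
  rw [coe_mpRk]; exact M.eRk_le_eRank X

/-- **EVERY PAVING MATROID SATISFIES (Diag)**: `Paving M → MinorPairDiagSkew M`. -/
theorem minorPairDiagSkew_of_paving (h : Paving M) : MinorPairDiagSkew M := by
  intro Y₁ Y₂ hY₁ hY₂ hdisj hI₁ hI₂ hle i hi
  rcases Nat.eq_zero_or_pos (minorPairCount M Y₁ Y₂ i) with h0 | hpos
  · rw [h0]; exact Nat.zero_le _
  obtain ⟨hsup₁, hsup₂⟩ := minorPairCount_support M hY₁ hY₂ hdisj hpos.ne'
  set m := (M.E \ (Y₁ ∪ Y₂)).ncard with hm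
  -- the reflected level is interior on both sides
  have hr₂ := mpRk_le_eRank M (M.E \ Y₂)
  have hr₁ := mpRk_le_eRank M (M.E \ Y₁)
  have hjY₁ : (((m - 1 - i) + Y₁.ncard : ℕ) : ℕ∞) < M.eRank := by
    have h1 : (m - 1 - i) + Y₁.ncard + 1 ≤ mpRk M (M.E \ Y₂) := by omega
    calc (((m - 1 - i) + Y₁.ncard : ℕ) : ℕ∞) < (((m - 1 - i) + Y₁.ncard + 1 : ℕ) : ℕ∞) := by
          exact_mod_cast Nat.lt_succ_self _
      _ ≤ ((mpRk M (M.E \ Y₂) : ℕ) : ℕ∞) := by exact_mod_cast h1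
      _ ≤ M.eRank := hr₂
  have hjY₂ : ((m - (m - 1 - i) + Y₂.ncard : ℕ) : ℕ∞) < M.eRank := by
    have h1 : m - (m - 1 - i) + Y₂.ncard + 1 ≤ mpRk M (M.E \ Y₁) := by omega
    calc ((m - (m - 1 - i) + Y₂.ncard : ℕ) : ℕ∞) < ((m - (m - 1 - i) + Y₂.ncard + 1 : ℕ) : ℕ∞) := by
          exact_mod_cast Nat.lt_succ_self _
      _ ≤ ((mpRk M (M.E \ Y₁) : ℕ) : ℕ∞) := by exact_mod_cast h1
      _ ≤ M.eRank := hr₁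
  calc minorPairCount M Y₁ Y₂ i ≤ m.choose i := minorPairCount_le_choose M Y₁ Y₂ i
    _ ≤ m.choose (m - 1 - i) := choose_le_choose_of_le_of_le_sub (by omega) (by omega)
    _ = minorPairCount M Y₁ Y₂ (m - 1 - i) :=
        (minorPairCount_eq_choose_of_paving M h hY₁ hY₂ hjY₁ hjY₂).symm

/-- **(M₀) FOR EVERY PAVING MATROID.** -/
theorem minorPairEqualRankSkew_of_paving (h : Paving M) : MinorPairEqualRankSkew M :=
  minorPairEqualRankSkew_of_diagSkew M (minorPairDiagSkew_of_paving M h)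

/-- **THE CUMULATIVE SKEW ON EVERY PAIR OF COMPLEMENTARY MINORS OF A PAVING MATROID**, with the natural parameter
`m − 1` (`r₁ ≥ r₂`) resp. `m − 1 − d` (`r₁ + d = r₂`). -/
theorem minorPairSkew_of_paving (h : Paving M) {Y₁ Y₂ : Set α} (hY₁ : Y₁ ⊆ M.E) (hY₂ : Y₂ ⊆ M.E)
    (hdisj : Disjoint Y₁ Y₂) (hI₁ : M.Indep Y₁) (hI₂ : M.Indep Y₂) :
    (mpRk M (M.E \ Y₁) + Y₁.ncard ≤ mpRk M (M.E \ Y₂) + Y₂.ncard →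
      MinorPairSkew M Y₁ Y₂ ((M.E \ (Y₁ ∪ Y₂)).ncard - 1)) ∧
    (∀ d : ℕ, mpRk M (M.E \ Y₂) + Y₂.ncard + d = mpRk M (M.E \ Y₁) + Y₁.ncard →
      MinorPairSkew M Y₁ Y₂ ((M.E \ (Y₁ ∪ Y₂)).ncard - 1 - d)) :=
  minorPairSkew_all_of_diagSkew M (minorPairDiagSkew_of_paving M h) _ Y₁ Y₂ hY₁ hY₂ hdisj hI₁ hI₂ rfl

/-- (CX*) for paving matroids, as a corollary of the pair theory (a second proof of g28's `biContainSkew_of_paving`). -/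
theorem biContainSkew_of_paving' (h : Paving M) : BiContainSkew M :=
  biContainSkew_of_diagSkew M (minorPairDiagSkew_of_paving M h)

/-- **(Diag) FOR EVERY UNIFORM MATROID** (uniform matroids are paving). -/
theorem minorPairDiagSkew_uniform {E : Set α} (hE : E.Finite) (q p : ℕ) :
    haveI := modelMatroid_finite hE ∅ q p
    MinorPairDiagSkew (modelMatroid hE ∅ q p) :=
  haveI := modelMatroid_finite hE ∅ q p
  minorPairDiagSkew_of_paving _ (uniform_paving hE q p)

/-- **(M₀) FOR EVERY UNIFORM MATROID.** -/
theorem minorPairEqualRankSkew_uniform {E : Set α} (hE : E.Finite) (q p : ℕ) :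
    haveI := modelMatroid_finite hE ∅ q p
    MinorPairEqualRankSkew (modelMatroid hE ∅ q p) :=
  haveI := modelMatroid_finite hE ∅ q p
  minorPairEqualRankSkew_of_paving _ (uniform_paving hE q p)

end PercRepro
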